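/-
Copyright (c) 2026 the pub-hodgecm-mathlib formalisation cell (harness21).  Prover seat hodgecm-mathlib-R90-C10-p07 (g2), SLAB R90-TF, section S1 «Ch. 10∕12 local»,
cell «U4-RAM :182 B_pos (ramified tame)» (dealer R90-C10-plan (g2), card (B-10)(5a) 2026-09-05T01:14:02Z): p01 (g3)'s LEMMA S of `PAPER-Pram1-cross.md` §2 — the skew-ball
character integrals at level `|Π|ᵐ`, `m ≥ 1`, at a TAME RAMIFIED place, for `χ₁` trivial on the `σ`-fixed PRINCIPAL units only.  KERNEL module: THEOREMS ONLY (no definition,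
no named fact, no `sorry`, no instance, no notation).  2026-09-05.
-/
import Summits.HodgeConjecture.HodgeConjecture.Theorems.R90S1BposSkewLineCharacterIntegralDepth   -- ★ (B-4) PART 2 p863275 (R90-C10-p04 (g2)): (ii) `setIntegral_skewBall_dite_one_add_eq_measureReal_of_trivial` (place-free); brings ★ PART 1 `R90S1BposSkewBallCharacterTools` (§1 orthogonality on an invariant set, §2 product decomposition), ★ (II)-b2∕b3a∕b1
import HarnessLib

/-!
# R90 · S1 ∕ U4Keys leaf (U4f-χ₁-ram-one-pos), BRANCH B AT A TAME RAMIFIED PLACE — brick (B-10)(5a): LEMMA S, THE SKEW-BALL CHARACTER INTEGRALS AT LEVEL `|Π|ᵐ` (`m ≥ 1`)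
# `∫_{t ∈ R⁻, |t|_w ≤ |Π|_wᵐ} χ₁((1 + t)^) dμ⁻(t) = μ⁻{|t|_w ≤ |Π|_wᵐ} · 𝟙[n ≤ m]` for `χ₁` of conductor `n` trivial on the `σ`-FIXED PRINCIPAL units   [Keys1984 §4–§5, §7 Thm (2) (d); WeilBNT1967 Ch. II §5; Roche1998 §3]

Cell `pub/hodgecm-mathlib` (D-0151), SLAB R90-TF, section S1 «Ch. 10∕12 local», crux H413 = `stmt-HodgeConjecture-24833` (lane `--supports … --as helper`), route of record
`HCCMUnconditional` (no route verbs); prover seat `hodgecm-mathlib-R90-C10-p07` (g2), card (B-10)(5a) of the ramified-tame corner of the B_pos line (dealer R90-C10-plan (g2)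
2026-09-05T01:14:02Z; author of LEMMA S: R90-C10-p01 (g3), `R90/R90-C10-p01/g3/PAPER-Pram1-cross.md` 285001636e231ee7 §2).  THEOREMS ONLY (no `def`, no `instance`, no notation, no
named-fact hypothesis, no `sorry`); ★-only imports (no `Lines` import).  NOT THE PAYER of :182: LEMMA S is the one analytic input of the EVEN shells and of the (R-a) odd shells of the
ramified positive-depth Casselman pair (PAPER §2); the COSET STEP (5b) `R90S1BposRamCosetIntegral`, the shell sums and the assembly are the line's other bricks.

FRAME (= ★ (B-4) PART 1∕2 v1 spellings): `R := LocalRing L v = L ⊗ L⁺_v` at a NON-SPLIT place `v` (`hw : c • w = w` for the place `w ∣ v` — a tame RAMIFIED `w` included: nothing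
below uses `e(w|v)`), `|2|_w = 1` (`h2w`); `σ := conjLocal L c v`, `R⁻ = HeisRing.skewPart σ`, `R⁺ = HeisRing.fixedPart σ`; `χ₁ : Rˣ →* ℂˣ` continuous; `E r := χ₁(r̂)` if `r` is a unit,
`0` otherwise (inline `dite`); `μ⁻ = μY` ANY regular additive Haar measure on `R⁻`.  RADII are VALUES `|r|` of elements `r ∈ L_w` (`0 < |r| < 1`; the consumers take `r = Πᵐ`,
`Π` a uniformiser of `L_w`, `1 ≤ m` — §3 spells that out with `Valued.v ϖ ^ m`).
THE BRANCH-B LETTER IS THE PRINCIPAL ONE: **`hfixP : ∀ u, (∀ w′, |(u − 1)_{w′}|_{w′} < 1) → σu = u → χ₁ u = 1`** — ★ p863838 `R90S1BposRamFixedPrincipalUnits.apply_eq_one_of_branchB_of_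
fixed_principal_ram (h2w) (χ₁) (hB)` BYTE FOR BYTE (Hensel: a `σ`-fixed principal unit is `a·σa`), valid at a RAMIFIED place, where the INERT letter `hfix` of ★ PART 1∕2 («`χ₁ = 1` on
ALL `σ`-fixed units of absolute value one») FAILS in sub-branch (R-b) (`χ₁|_{𝒪_Fˣ} = ε`, PAPER §0).  The observation of this file: ★ PART 2 (i)'s proof uses `hfix` ONLY on the fibres
over `P = {a ∈ R⁺ : |a − 1|_w ≤ |r|}` — PRINCIPAL fixed units — so the principal letter suffices.

* §1 **`setIntegral_skewBall_dite_add_eq_of_fixed_principal`** — THE FIBRE IS CONSTANT over a `σ`-fixed PRINCIPAL `a` (`|a − 1|_w < 1`): `∫_{|y| ≤ |r|} E(a + y) dμ⁻ = ∫_{|y| ≤ |r|}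
  E(1 + y) dμ⁻` (★ PART 1 §3's proof with `hχâ := hfixP â`).
* §2 **`setIntegral_skewBall_dite_one_add_eq_zero_of_level_principal`** (LEMMA S, vanishing half) — `∫_{|y|_w ≤ |r|} E(1 + y) dμ⁻ = 0` whenever `χ₁` is non-trivial on the principal
  units of level `|r|` (a unit `u₀`, `|(u₀ − 1)_w| ≤ |r|`, `χ₁ u₀ ≠ 1`), `0 < |r| < 1` (★ PART 2 (i)'s proof verbatim, §1 for the fibres); `…_diteInv_…` the `χ₁⁻¹` reading
  (`inv_letters_principal`).  The mass half (`χ₁` trivial at level `|r|`) is ★ PART 2 (ii) `setIntegral_skewBall_dite_one_add_eq_measureReal_of_trivial`, place-free already.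
* §3 **LEMMA S IN THE `|Π|ᵐ` CURRENCY of the ramified C-pack** (`ϖ = Π`, `Valued.v ϖ = exp(−1)`; conductor letters ★ p863496's bytes `hcond` at level `n` ∕ sharp witness `u₁ hu₁ hχu₁` at
  level `m`): **`setIntegral_skewBall_pow_dite_one_add_eq_zero`** (`1 ≤ m`, witness at level `m` ⟹ `= 0`: the shells `m < n`), **`setIntegral_skewBall_pow_dite_one_add_eq_measureReal`**
  (`n ≤ m` ⟹ `= μ⁻(ball)`: the shells `m ≥ n`), and the `χ₁⁻¹` reading of the first.
HONEST LABEL.  HC_CM is proved only modulo the 7 printed citations (2 remaining named inputs: hLiu418 = `stmt-HodgeConjecture-24832`, h413 = `stmt-HodgeConjecture-24833`) until rung 0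
closes; count-neutral — this file does NOT pay :182 (nor :155, nor A2′); no printed citation is discharged; REL ≠ ★ ≠ BUILT.

## References
* [Keys1984] D. Keys, *Principal series representations of special unitary groups over local fields*, Compositio Math. 51 (1984), §4–§5, §7 Theorem (2) (d) p. 126.
* [WeilBNT1967] A. Weil, *Basic Number Theory* (1967), Ch. I §2–§4, Ch. II §5 (Haar measure under homotheties; orthogonality of a non-trivial character of a compact group).
* [Roche1998] A. Roche, *Types and Hecke algebras for principal series representations of split reductive p-adic groups*, Ann. Sci. ÉNS (4) 31 (1998), §3–§4.
* [Rogawski1990] J. D. Rogawski, *Automorphic Representations of Unitary Groups in Three Variables*, Ann. of Math. Stud. 123 (1990), §1.10 p. 9, §12.2 (2) p. 173.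
-/

set_option autoImplicit false
-- the mandated namespace has the single-problem summit's repeated segment (`HodgeConjecture.HodgeConjecture`)
set_option linter.dupNamespace false

noncomputable section

open NumberField IsDedekindDomain MeasureTheory Measure Topology Set
open scoped NNReal ENNReal
open Literature.NumberTheory Literature.NumberTheory.Automorphic Literature.NumberTheory.Automorphic.UnitaryGroup

namespace Summit.HodgeConjecture.HodgeConjecture.R90.S1.BposRamSkewBallCharacterIntegral

open Summit.HodgeConjecture.HodgeConjecture.Cruxes.H413
open Summit.HodgeConjecture.HodgeConjecture.Cruxes.H413.K2E3BranchBSkewUnitSign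
open Summit.HodgeConjecture.HodgeConjecture.Cruxes.H413.K2E3BranchBSkewLineIntegrals
open Summit.HodgeConjecture.HodgeConjecture.Cruxes.H413.K2E3BranchBSkewLineCharacterIntegral
open Summit.HodgeConjecture.HodgeConjecture.R90.S1.BposSkewBallCharacterTools
open Summit.HodgeConjecture.HodgeConjecture.R90.S1.BposSkewLineCharacterIntegralDepth

variable (L : Type) [Field L] [NumberField L] [IsCMField L] (v : HeightOneSpectrum (𝓞 ↥(maximalRealSubfield L)))
  (w : PlacesOver L v) (hw : IsCMField.complexConj L • w.1 = w.1)

section SkewBall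

variable [MeasurableSpace (LocalRing L v)] [BorelSpace (LocalRing L v)]
  (μY : Measure ↥(HeisRing.skewPart (conjLocal L (IsCMField.complexConj L) v))) [μY.IsAddHaarMeasure] [μY.Regular]

/-- The ball `{y ∈ R⁻ : |y_w| ≤ |r|}` of the skew line, radius the value of an element `r ∈ L_w`, is Borel (closed). [cite: Rogawski1990, §1.10 p. 9] -/
theorem measurableSet_skewBall_val (r : w.1.adicCompletion L) :
    MeasurableSet {y : ↥(HeisRing.skewPart (conjLocal L (IsCMField.complexConj L) v)) | Valued.v ((y : LocalRing L v) w) ≤ Valued.v r} := by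
  have hR : IsClosed {x : LocalRing L v | Valued.v (x w) ≤ Valued.v r} := by
    have h : {x : LocalRing L v | Valued.v (x w) ≤ Valued.v r} = (fun x : LocalRing L v => x w) ⁻¹' {z : w.1.adicCompletion L | Valued.v z ≤ Valued.v r} := rfl
    rw [h]
    exact (isClosed_setOf_valued_le_valued L v w r).preimage (continuous_apply w)
  exact measurable_subtype_coe hR.measurableSet

/-! ## §1 THE FIBRE IS CONSTANT over a `σ`-fixed PRINCIPAL `a` -/

open scoped Classical in
include hw in
/-- **THE FIBRE IS CONSTANT OVER A PRINCIPAL FIXED UNIT — `∫_{|y|_w ≤ |r|} E(a + y) dμ⁻ = ∫_{|y|_w ≤ |r|} E(1 + y) dμ⁻`** for a `σ`-fixed `a` with `|(a − 1)_w| < 1` (so `|a_w| = 1`) and a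
radius `|r| ≤ 1`, when `χ₁ = 1` on the `σ`-fixed PRINCIPAL units (`hfixP`, ★ p863838's shape — ramified places included): `χ₁((a + y)^) = χ₁(â)·χ₁((1 + â⁻¹y)^)` with `χ₁(â) = 1`
(`â` is `σ`-fixed and principal), and `y ↦ â⁻¹y` (★ `HeisRing.smulSkew`) preserves the ball (`|â⁻¹|_w = 1`) and `μ⁻` (`χ⁻(â⁻¹) = √‖â⁻¹‖_R = 1`).  ★ PART 1 §3's proof, the one use of
the Branch-B letter moved to the principal units. [cite: Keys1984, §4, §7 Theorem (2) p. 126] [cite: WeilBNT1967, Ch. II §5] -/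
theorem setIntegral_skewBall_dite_add_eq_of_fixed_principal (h2w : Valued.v (2 : w.1.adicCompletion L) = 1) (χ₁ : (LocalRing L v)ˣ →* ℂˣ)
    (hfixP : ∀ u : (LocalRing L v)ˣ, (∀ w' : PlacesOver L v, Valued.v (((u : LocalRing L v) w') - 1) < 1) →
      conjLocal L (IsCMField.complexConj L) v (u : LocalRing L v) = u → χ₁ u = 1)
    (r : w.1.adicCompletion L) (hr1 : Valued.v r ≤ 1)
    {a : LocalRing L v} (ha : conjLocal L (IsCMField.complexConj L) v a = a) (hap : Valued.v ((a - 1) w) < 1) :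
    ∫ y in {y : ↥(HeisRing.skewPart (conjLocal L (IsCMField.complexConj L) v)) | Valued.v ((y : LocalRing L v) w) ≤ Valued.v r},
        (fun r : LocalRing L v => if h : IsUnit r then ((χ₁ h.unit : ℂˣ) : ℂ) else 0) (a + (y : LocalRing L v)) ∂μY =
      ∫ y in {y : ↥(HeisRing.skewPart (conjLocal L (IsCMField.complexConj L) v)) | Valued.v ((y : LocalRing L v) w) ≤ Valued.v r},
        (fun r : LocalRing L v => if h : IsUnit r then ((χ₁ h.unit : ℂˣ) : ℂ) else 0) (1 + (y : LocalRing L v)) ∂μY := by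
  letI : Invertible (2 : LocalRing L v) := (isUnit_two_localRing L v).invertible
  haveI : SecondCountableTopology (LocalRing L v) := secondCountableTopology_localRing (E := L) v
  have hσ := conjLocal_conjLocal_cm L v
  have hσc := continuous_conjLocal L (IsCMField.complexConj L) v
  -- `|a_w| = 1`
  have hav : Valued.v (a w) = 1 := by
    have h : a w = 1 + (a - 1) w := by rw [Pi.sub_apply, Pi.one_apply, add_sub_cancel]
    rw [h]; exact Valuation.map_one_add_of_lt _ hap
  -- the unit `â` and its inverse
  have haU : IsUnit a := K2E3DepthZeroIwahoriCharacterCM.isUnit_of_apply_ne_zero L v w hw a (fun h => by rw [h, map_zero] at hav; exact zero_ne_one hav)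
  set â : (LocalRing L v)ˣ := haU.unit with hâ
  have hâa : (â : LocalRing L v) = a := haU.unit_spec
  have hâfix : conjLocal L (IsCMField.complexConj L) v (â : LocalRing L v) = â := by rw [hâa]; exact ha
  have hâinvfix : conjLocal L (IsCMField.complexConj L) v (((â⁻¹ : (LocalRing L v)ˣ)) : LocalRing L v) = ((â⁻¹ : (LocalRing L v)ˣ) : LocalRing L v) :=
    HeisRing.map_units_inv_of_fixed (conjLocal L (IsCMField.complexConj L) v) â hâfix
  have hâv : Valued.v ((â : LocalRing L v) w) = 1 := by rw [hâa]; exact hav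
  have hâinvv : Valued.v (((â⁻¹ : (LocalRing L v)ˣ) : LocalRing L v) w) = 1 := valued_units_inv_apply_eq_one L v hâv
  -- the one use of the Branch-B letter: `â` is a `σ`-fixed PRINCIPAL unit
  have hχâ : χ₁ â = 1 := hfixP â (forall_placesOver_of_apply L v w hw (by rw [hâa]; simpa only [Pi.sub_apply, Pi.one_apply] using hap)) hâfix
  set B : Set ↥(HeisRing.skewPart (conjLocal L (IsCMField.complexConj L) v)) :=
    {y | Valued.v ((y : LocalRing L v) w) ≤ Valued.v r} with hBdef
  have hmeasB : MeasurableSet B := measurableSet_skewBall_val L v w r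
  -- (i) the integrand: `χ₁((a + y)^) = χ₁((1 + a⁻¹ y)^)` on the ball
  have hpt : ∀ y ∈ B,
      (fun r : LocalRing L v => if h : IsUnit r then ((χ₁ h.unit : ℂˣ) : ℂ) else 0) (a + (y : LocalRing L v)) =
        (fun r : LocalRing L v => if h : IsUnit r then ((χ₁ h.unit : ℂˣ) : ℂ) else 0) (1 + ((â⁻¹ : (LocalRing L v)ˣ) : LocalRing L v) * (y : LocalRing L v)) := by
    intro y hy
    have hy1 : Valued.v ((y : LocalRing L v) w) ≤ 1 := le_trans hy hr1
    have hskew' : conjLocal L (IsCMField.complexConj L) v (((â⁻¹ : (LocalRing L v)ˣ) : LocalRing L v) * (y : LocalRing L v)) =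
        -(((â⁻¹ : (LocalRing L v)ˣ) : LocalRing L v) * (y : LocalRing L v)) := by
      rw [map_mul, hâinvfix, (HeisRing.mem_skewPart_iff _ _).1 y.2, mul_neg]
    have hv1 : Valued.v ((1 + ((â⁻¹ : (LocalRing L v)ˣ) : LocalRing L v) * (y : LocalRing L v)) w) = 1 := by
      rw [valued_add_apply_eq_max L v w hw h2w (by rw [map_one]) hskew', Pi.one_apply, map_one, max_eq_left_iff, Pi.mul_apply, map_mul, hâinvv, one_mul]
      exact hy1
    have hU1 : IsUnit (1 + ((â⁻¹ : (LocalRing L v)ˣ) : LocalRing L v) * (y : LocalRing L v)) :=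
      K2E3DepthZeroIwahoriCharacterCM.isUnit_of_apply_ne_zero L v w hw _ (fun h => by rw [h] at hv1; exact zero_ne_one (by rw [← hv1, map_zero]))
    have hUa : IsUnit (a + (y : LocalRing L v)) := by
      have : a + (y : LocalRing L v) = (â : LocalRing L v) * (1 + ((â⁻¹ : (LocalRing L v)ˣ) : LocalRing L v) * (y : LocalRing L v)) := by
        rw [mul_add, mul_one, ← mul_assoc, Units.mul_inv, one_mul, hâa]
      rw [this]; exact haU.unit.isUnit.mul hU1
    simp only [dif_pos hUa, dif_pos hU1]
    have hunits : hUa.unit = â * hU1.unit := by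
      apply Units.ext
      rw [hUa.unit_spec, Units.val_mul, hU1.unit_spec, mul_add, mul_one, ← mul_assoc, Units.mul_inv, one_mul, hâa]
    rw [hunits, map_mul, hχâ, one_mul]
  rw [setIntegral_congr_fun hmeasB hpt]
  -- (ii) the substitution `y ↦ a⁻¹ y`
  set T := HeisRing.smulSkew (conjLocal L (IsCMField.complexConj L) v) (â⁻¹) hâinvfix with hT
  obtain ⟨δ, hδ⟩ := exists_conjLocal_skew_unit L v
  have hmod : HeisRing.skewModulus (conjLocal L (IsCMField.complexConj L) v) hσc (â⁻¹) hâinvfix = 1 := by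
    rw [HeisRing.skewModulus_eq_sqrt (conjLocal L (IsCMField.complexConj L) v) hσ hσc δ hδ (â⁻¹) hâinvfix,
      show distribHaarChar (LocalRing L v) â⁻¹ = unitModulusChar (LocalRing L v) â⁻¹ from rfl,
      unitModulusChar_eq_one_of_forall_v_eq_one L v â⁻¹ (forall_placesOver_of_apply L v w hw hâinvv), NNReal.sqrt_one]
  have hpres : MeasurePreserving T μY μY := by
    refine ⟨T.continuous.measurable, ?_⟩
    rw [hT, HeisRing.map_smulSkew_eq (conjLocal L (IsCMField.complexConj L) v) hσc (â⁻¹) hâinvfix μY, hmod, inv_one, one_smul]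
  have hpre : T ⁻¹' B = B := by
    ext y
    rw [Set.mem_preimage, hBdef, Set.mem_setOf_eq, Set.mem_setOf_eq, hT, HeisRing.coe_smulSkew, Pi.mul_apply, map_mul, hâinvv, one_mul]
  have key := hpres.setIntegral_preimage_emb T.toHomeomorph.measurableEmbedding
    (fun y : ↥(HeisRing.skewPart (conjLocal L (IsCMField.complexConj L) v)) =>
      (fun r : LocalRing L v => if h : IsUnit r then ((χ₁ h.unit : ℂˣ) : ℂ) else 0) (1 + (y : LocalRing L v))) B
  rw [hpre] at key
  rw [← key]
  rfl

/-! ## §2 LEMMA S, vanishing half: the skew-ball character integral at a non-trivial level vanishes -/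

open scoped Classical in
include hw in
/-- **LEMMA S (vanishing half) — `∫_{y ∈ R⁻, |y|_w ≤ |r|} χ₁((1 + y)^) dμ⁻(y) = 0`** whenever `χ₁` is NON-TRIVIAL on the principal units of level `|r|` (a unit `u₀` with
`|(u₀ − 1)_w| ≤ |r|` and `χ₁ u₀ ≠ 1`; `0 < |r| < 1`, e.g. `r = Πᵐ`, `1 ≤ m < cond χ₁`), for a continuous `χ₁` trivial on the `σ`-fixed PRINCIPAL units (`hfixP` — at a TAME RAMIFIED place
in BRANCH B this is ★ `apply_eq_one_of_branchB_of_fixed_principal_ram (h2w) (χ₁) (hB)`), `|2|_w = 1`, and EVERY regular additive Haar measure `μ⁻` on `R⁻`.  (PAPER-Pram1-cross §2: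
«`∫_{E⁻∩𝔭^m} χ₁(1+t) dt = vol·𝟙[m ≥ n]`» — every EVEN shell and, through `T(x)`, the (R-a) odd shells of the ramified positive-depth Casselman pair.)  PROOF: ★ PART 2 (i) verbatim —
★ PART 1 §1 on the `u₀`-invariant set `A = {b : |(b − 1)_w| ≤ |r|}`, §2 with `P = {|a − 1| ≤ |r|}`, `Y = {|y| ≤ |r|}`, and §1 of THIS file for the fibres (every `a ∈ P` is a PRINCIPAL
fixed unit); `0 = μ⁺(P)·Φ` with `0 < μ⁺(P) < ∞`. [cite: Keys1984, §4–§5, §7 Theorem (2) p. 126] [cite: WeilBNT1967, Ch. II §5] [cite: Roche1998, §3–§4] -/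
theorem setIntegral_skewBall_dite_one_add_eq_zero_of_level_principal (h2w : Valued.v (2 : w.1.adicCompletion L) = 1)
    (χ₁ : (LocalRing L v)ˣ →* ℂˣ) (h₁ : Continuous fun x => ((χ₁ x : ℂˣ) : ℂ))
    (hfixP : ∀ u : (LocalRing L v)ˣ, (∀ w' : PlacesOver L v, Valued.v (((u : LocalRing L v) w') - 1) < 1) →
      conjLocal L (IsCMField.complexConj L) v (u : LocalRing L v) = u → χ₁ u = 1)
    (r : w.1.adicCompletion L) (hr0 : Valued.v r ≠ 0) (hr1 : Valued.v r < 1)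
    (u₀ : (LocalRing L v)ˣ) (hu₀ : Valued.v (((u₀ : LocalRing L v) - 1) w) ≤ Valued.v r) (hχ : χ₁ u₀ ≠ 1) :
    ∫ y in {y : ↥(HeisRing.skewPart (conjLocal L (IsCMField.complexConj L) v)) | Valued.v ((y : LocalRing L v) w) ≤ Valued.v r},
        (fun r : LocalRing L v => if h : IsUnit r then ((χ₁ h.unit : ℂˣ) : ℂ) else 0) (1 + (y : LocalRing L v)) ∂μY = 0 := by
  letI : Invertible (2 : LocalRing L v) := (isUnit_two_localRing L v).invertible
  haveI : SecondCountableTopology (LocalRing L v) := secondCountableTopology_localRing (E := L) v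
  have hσc := continuous_conjLocal L (IsCMField.complexConj L) v
  haveI := HeisRing.locallyCompactSpace_fixedPart (conjLocal L (IsCMField.complexConj L) v) hσc
  haveI := HeisRing.locallyCompactSpace_skewPart (conjLocal L (IsCMField.complexConj L) v) hσc
  haveI : SecondCountableTopology ↥(HeisRing.fixedPart (conjLocal L (IsCMField.complexConj L) v)) := TopologicalSpace.Subtype.secondCountableTopology _
  haveI : SecondCountableTopology ↥(HeisRing.skewPart (conjLocal L (IsCMField.complexConj L) v)) := TopologicalSpace.Subtype.secondCountableTopology _
  -- names
  set E : LocalRing L v → ℂ := fun r : LocalRing L v => if h : IsUnit r then ((χ₁ h.unit : ℂˣ) : ℂ) else 0 with hEdef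
  set c : _ := Valued.v r with hcdef
  set A : Set (LocalRing L v) := {b | Valued.v ((b - 1) w) ≤ c} with hAdef
  set P : Set ↥(HeisRing.fixedPart (conjLocal L (IsCMField.complexConj L) v)) := {a | Valued.v (((a : LocalRing L v) - 1) w) ≤ c} with hPdef
  set Y : Set ↥(HeisRing.skewPart (conjLocal L (IsCMField.complexConj L) v)) := {y | Valued.v ((y : LocalRing L v) w) ≤ c} with hYdef
  set Φ : ℂ := ∫ y in Y, E (1 + (y : LocalRing L v)) ∂μY with hΦdef
  -- valuation bookkeeping: a unit of level `c` has absolute value one, and level `c` is stable under such units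
  have hval1 : ∀ b : LocalRing L v, Valued.v ((b - 1) w) ≤ c → Valued.v (b w) = 1 := fun b hb => by
    have h : b w = 1 + (b - 1) w := by rw [Pi.sub_apply, Pi.one_apply, add_sub_cancel]
    rw [h]; exact Valuation.map_one_add_of_lt _ (lt_of_le_of_lt hb hr1)
  have hstep : ∀ (u : (LocalRing L v)ˣ) (b : LocalRing L v), Valued.v (((u : LocalRing L v) - 1) w) ≤ c → Valued.v ((b - 1) w) ≤ c →
      Valued.v (((u : LocalRing L v) * b - 1) w) ≤ c := fun u b hu hb => by
    have h : ((u : LocalRing L v) * b - 1) w = (u : LocalRing L v) w * ((b - 1) w) + ((u : LocalRing L v) - 1) w := by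
      simp only [Pi.sub_apply, Pi.mul_apply, Pi.one_apply]; ring
    rw [h]
    refine (Valuation.map_add _ _ _).trans (max_le ?_ hu)
    rw [map_mul, hval1 _ hu, one_mul]; exact hb
  have hu₀inv : Valued.v ((((u₀⁻¹ : (LocalRing L v)ˣ) : LocalRing L v) - 1) w) ≤ c := by
    have h : (((u₀⁻¹ : (LocalRing L v)ˣ) : LocalRing L v) - 1) w = -((((u₀⁻¹ : (LocalRing L v)ˣ) : LocalRing L v) w) * (((u₀ : LocalRing L v) - 1) w)) := by
      have h1 := units_apply_mul_inv_apply L v u₀ w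
      simp only [Pi.sub_apply, Pi.one_apply]
      linear_combination h1
    rw [h, Valuation.map_neg, map_mul, valued_units_inv_apply_eq_one L v (hval1 _ hu₀), one_mul]; exact hu₀
  -- the set `A` is Borel, made of units of absolute value one, and `u₀`-invariant
  have hA : MeasurableSet A := by
    have h : A = (fun b : LocalRing L v => (b - 1) w) ⁻¹' {z : w.1.adicCompletion L | Valued.v z ≤ c} := rfl
    rw [h]
    exact ((isClosed_setOf_valued_le_valued L v w r).preimage ((continuous_apply w).comp (continuous_id.sub continuous_const))).measurableSet
  have hA1 : ∀ b ∈ A, Valued.v (b w) = 1 := fun b hb => hval1 b hb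
  have hAu : ∀ b : LocalRing L v, (u₀ : LocalRing L v) * b ∈ A ↔ b ∈ A := fun b => by
    refine ⟨fun h => ?_, fun h => hstep u₀ b hu₀ h⟩
    have h' := hstep u₀⁻¹ ((u₀ : LocalRing L v) * b) hu₀inv h
    rwa [← mul_assoc, Units.inv_mul, one_mul] at h'
  have hu₀' : ∀ w' : PlacesOver L v, Valued.v ((u₀ : LocalRing L v) w') = 1 := forall_placesOver_of_apply L v w hw (hval1 _ hu₀)
  -- the product structure of `A` in `R = R⁺ ⊕ R⁻`
  have hP1 : P ⊆ {a | Valued.v ((a : LocalRing L v) w) ≤ 1} := fun a ha => (hval1 _ ha).le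
  have hY1 : Y ⊆ {y | Valued.v ((y : LocalRing L v) w) ≤ 1} := fun y hy => (lt_of_le_of_lt hy hr1).le
  have hAPY : ∀ (a : ↥(HeisRing.fixedPart (conjLocal L (IsCMField.complexConj L) v))) (y : ↥(HeisRing.skewPart (conjLocal L (IsCMField.complexConj L) v))),
      (a : LocalRing L v) + (y : LocalRing L v) ∈ A ↔ a ∈ P ∧ y ∈ Y := fun a y => by
    have ha : conjLocal L (IsCMField.complexConj L) v ((a : LocalRing L v) - 1) = (a : LocalRing L v) - 1 := by
      rw [map_sub, map_one, (HeisRing.mem_fixedPart_iff _ _).1 a.2]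
    have hmax := valued_add_apply_eq_max L v w hw h2w ha ((HeisRing.mem_skewPart_iff _ _).1 y.2)
    show Valued.v (((a : LocalRing L v) + (y : LocalRing L v) - 1) w) ≤ c ↔ _
    rw [show (a : LocalRing L v) + (y : LocalRing L v) - 1 = ((a : LocalRing L v) - 1) + (y : LocalRing L v) by ring, hmax, max_le_iff]
    rfl
  -- an additive Haar measure `μ⁺` on `R⁺` (transported from `μ⁻` by a skew unit) and the Haar measure `(μ⁺ ⊗ μ⁻) ∘ ringDecomp⁻¹` on `R`
  obtain ⟨δ, hδ⟩ := exists_conjLocal_skew_unit L v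
  set eP := HeisRing.mulSkewUnit (conjLocal L (IsCMField.complexConj L) v) δ hδ with hePdef
  set μP : Measure ↥(HeisRing.fixedPart (conjLocal L (IsCMField.complexConj L) v)) := μY.map eP.symm with hμPdef
  haveI hμP : μP.IsAddHaarMeasure := ContinuousAddEquiv.isAddHaarMeasure_map μY eP.symm
  haveI : (μP.prod μY).IsAddHaarMeasure := inferInstance
  haveI : ((μP.prod μY).map (HeisRing.ringDecomp (conjLocal L (IsCMField.complexConj L) v) (conjLocal_conjLocal_cm L v) hσc).symm).IsAddHaarMeasure :=
    ContinuousAddEquiv.isAddHaarMeasure_map (μP.prod μY) (HeisRing.ringDecomp (conjLocal L (IsCMField.complexConj L) v) (conjLocal_conjLocal_cm L v) hσc).symm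
  -- ★ PART 1 §1 orthogonality, §2 decomposition; §1 of this file: constancy of the fibre over PRINCIPAL fixed units
  have horth := integral_indicator_dite_eq_zero_of_mul_mem_iff L v w hw
    ((μP.prod μY).map (HeisRing.ringDecomp (conjLocal L (IsCMField.complexConj L) v) (conjLocal_conjLocal_cm L v) hσc).symm) χ₁ h₁ u₀ hu₀' hχ hA hAu
  rw [integral_indicator_dite_map_ringDecomp_eq_of_prod L v w hw χ₁ h₁ μP μY hA hA1 hP1 hY1 hAPY] at horth
  have hfib : ∀ a : ↥(HeisRing.fixedPart (conjLocal L (IsCMField.complexConj L) v)),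
      P.indicator (fun a' => ∫ y in Y, E ((a' : LocalRing L v) + (y : LocalRing L v)) ∂μY) a = P.indicator (fun _ => Φ) a := fun a => by
    by_cases ha : a ∈ P
    · rw [Set.indicator_of_mem ha, Set.indicator_of_mem ha]
      exact setIntegral_skewBall_dite_add_eq_of_fixed_principal L v w hw μY h2w χ₁ hfixP r hr1.le ((HeisRing.mem_fixedPart_iff _ _).1 a.2) (lt_of_le_of_lt ha hr1)
    · rw [Set.indicator_of_notMem ha, Set.indicator_of_notMem ha]
  have hPm : MeasurableSet P := measurable_subtype_coe hA
  rw [integral_congr_ae (Filter.Eventually.of_forall hfib), integral_indicator_const Φ hPm, Complex.real_smul] at horth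
  -- `0 < μ⁺(P) < ∞`
  have hPo : IsOpen P := by
    have h : P = (fun a : ↥(HeisRing.fixedPart (conjLocal L (IsCMField.complexConj L) v)) => ((a : LocalRing L v) - 1) w) ⁻¹'
        {z : w.1.adicCompletion L | Valued.v z ≤ c} := rfl
    rw [h]
    exact (isOpen_setOf_valued_le_valued L v w hr0).preimage ((continuous_apply w).comp (continuous_subtype_val.sub continuous_const))
  have hPne : P.Nonempty := ⟨⟨1, (HeisRing.mem_fixedPart_iff _ _).2 (map_one _)⟩, by
    show Valued.v (((1 : LocalRing L v) - 1) w) ≤ c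
    rw [sub_self, Pi.zero_apply, map_zero]; exact _root_.zero_le⟩
  have hPfin : μP P ≠ ⊤ := by
    have hBPc : IsCompact {a : ↥(HeisRing.fixedPart (conjLocal L (IsCMField.complexConj L) v)) | Valued.v ((a : LocalRing L v) w) ≤ 1} :=
      (HeisRing.isClosed_fixedPart _ hσc).isClosedEmbedding_subtypeVal.isCompact_preimage (isCompact_setOf_valued_apply_le_one L v w hw)
    exact ((measure_mono hP1).trans_lt hBPc.measure_lt_top).ne
  have hPpos : (μP.real P : ℂ) ≠ 0 := by
    rw [Ne, Complex.ofReal_eq_zero, measureReal_def, ENNReal.toReal_eq_zero_iff, not_or]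
    exact ⟨(hPo.measure_pos μP hPne).ne', hPfin⟩
  exact (mul_eq_zero.1 horth).resolve_left hPpos

omit [MeasurableSpace (LocalRing L v)] [BorelSpace (LocalRing L v)] in
/-- The principal letters are inversion-stable: continuity, «`χ₁ = 1` on the `σ`-fixed principal units», and the level witness pass from `χ₁` to `χ₁⁻¹`. [cite: WeilBNT1967, Ch. II §5] -/
theorem inv_letters_principal (χ₁ : (LocalRing L v)ˣ →* ℂˣ) (h₁ : Continuous fun x => ((χ₁ x : ℂˣ) : ℂ))
    (hfixP : ∀ u : (LocalRing L v)ˣ, (∀ w' : PlacesOver L v, Valued.v (((u : LocalRing L v) w') - 1) < 1) →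
      conjLocal L (IsCMField.complexConj L) v (u : LocalRing L v) = u → χ₁ u = 1)
    (u₀ : (LocalRing L v)ˣ) (hχ : χ₁ u₀ ≠ 1) :
    (Continuous fun x => ((χ₁⁻¹ x : ℂˣ) : ℂ)) ∧
      (∀ u : (LocalRing L v)ˣ, (∀ w' : PlacesOver L v, Valued.v (((u : LocalRing L v) w') - 1) < 1) →
        conjLocal L (IsCMField.complexConj L) v (u : LocalRing L v) = u → χ₁⁻¹ u = 1) ∧
      χ₁⁻¹ u₀ ≠ 1 := by
  refine ⟨?_, fun u hu hσu => by rw [MonoidHom.inv_apply, hfixP u hu hσu, inv_one], by rwa [MonoidHom.inv_apply, Ne, inv_eq_one]⟩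
  have h : (fun x => ((χ₁⁻¹ x : ℂˣ) : ℂ)) = fun x => (((χ₁ x : ℂˣ) : ℂ))⁻¹ := by
    funext x; rw [MonoidHom.inv_apply, Units.val_inv_eq_inv_val]
  rw [h]
  exact h₁.inv₀ fun x => Units.ne_zero _

open scoped Classical in
include hw in
/-- **(vanishing half, `χ₁⁻¹` reading) `∫_{y ∈ R⁻, |y|_w ≤ |r|} χ₁((1 + y)^)⁻¹ dμ⁻(y) = 0`** under the hypotheses of the vanishing half (the ramified Casselman entries carry
`χ₁(σz)⁻¹`; the letters are inversion-stable, `inv_letters_principal`). [cite: Keys1984, §4–§5, §7 Theorem (2) p. 126] -/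
theorem setIntegral_skewBall_diteInv_one_add_eq_zero_of_level_principal (h2w : Valued.v (2 : w.1.adicCompletion L) = 1)
    (χ₁ : (LocalRing L v)ˣ →* ℂˣ) (h₁ : Continuous fun x => ((χ₁ x : ℂˣ) : ℂ))
    (hfixP : ∀ u : (LocalRing L v)ˣ, (∀ w' : PlacesOver L v, Valued.v (((u : LocalRing L v) w') - 1) < 1) →
      conjLocal L (IsCMField.complexConj L) v (u : LocalRing L v) = u → χ₁ u = 1)
    (r : w.1.adicCompletion L) (hr0 : Valued.v r ≠ 0) (hr1 : Valued.v r < 1)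
    (u₀ : (LocalRing L v)ˣ) (hu₀ : Valued.v (((u₀ : LocalRing L v) - 1) w) ≤ Valued.v r) (hχ : χ₁ u₀ ≠ 1) :
    ∫ y in {y : ↥(HeisRing.skewPart (conjLocal L (IsCMField.complexConj L) v)) | Valued.v ((y : LocalRing L v) w) ≤ Valued.v r},
        (fun r : LocalRing L v => if h : IsUnit r then (((χ₁ h.unit)⁻¹ : ℂˣ) : ℂ) else 0) (1 + (y : LocalRing L v)) ∂μY = 0 := by
  obtain ⟨h₁', hfixP', hχ'⟩ := inv_letters_principal L v χ₁ h₁ hfixP u₀ hχ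
  exact setIntegral_skewBall_dite_one_add_eq_zero_of_level_principal L v w hw μY h2w χ₁⁻¹ h₁' hfixP' r hr0 hr1 u₀ hu₀ hχ'

/-! ## §3 LEMMA S in the `|Π|ᵐ` currency of the ramified C-pack (`Valued.v ϖ = exp(−1)`, `1 ≤ m`; conductor letters ★ p863496's bytes) -/

omit [IsCMField L] [MeasurableSpace (LocalRing L v)] [BorelSpace (LocalRing L v)] in
/-- `0 < |Πᵐ| < 1` for a uniformiser `Π` of `L_w` (`|Π| = exp(−1)`) and `1 ≤ m`; `|Πᵐ| = |Π|ᵐ`. [folklore] -/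
theorem valued_pow_uniformizer {ϖ : w.1.adicCompletion L} (hϖ : Valued.v ϖ = WithZero.exp (-1 : ℤ)) {m : ℕ} (hm : 1 ≤ m) :
    Valued.v (ϖ ^ m) = Valued.v ϖ ^ m ∧ Valued.v ϖ ^ m ≠ 0 ∧ Valued.v ϖ ^ m < 1 := by
  refine ⟨map_pow _ _ _, pow_ne_zero _ (by rw [hϖ]; exact WithZero.exp_ne_zero), ?_⟩
  have h1 : Valued.v ϖ < 1 := by rw [hϖ, ← WithZero.exp_zero, WithZero.exp_lt_exp]; norm_num
  exact pow_lt_one₀ zero_le h1 (by omega)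

open scoped Classical in
include hw in
/-- **LEMMA S AT LEVEL `|Π|ᵐ`, VANISHING CASE (`1 ≤ m`, a sharp witness at level `m`: the shells `m < n = cond χ₁`)** — `∫_{t ∈ R⁻, |t|_w ≤ |Π|_wᵐ} χ₁((1 + t)^) dμ⁻(t) = 0`, for a
continuous `χ₁` trivial on the `σ`-fixed principal units (`hfixP`, ★ p863838's letter), `|2|_w = 1`, and a unit `u₁` with `|(u₁ − 1)_{w′}| ≤ |Π|ᵐ` at every `w′ ∣ v` and `χ₁ u₁ ≠ 1` (★ C-pack's
`u₁ hu₁ hχu₁` bytes at level `m`; the conductor's sharp witness at level `n − 1` serves every `m ≤ n − 1`).  (PAPER-Pram1-cross §2 LEMMA S, `m < n`.) [cite: Keys1984, §4–§5, §7 Theorem (2) (d) p. 126]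
[cite: WeilBNT1967, Ch. II §5] [cite: Roche1998, §3] -/
theorem setIntegral_skewBall_pow_dite_one_add_eq_zero (h2w : Valued.v (2 : w.1.adicCompletion L) = 1)
    (χ₁ : (LocalRing L v)ˣ →* ℂˣ) (h₁ : Continuous fun x => ((χ₁ x : ℂˣ) : ℂ))
    (hfixP : ∀ u : (LocalRing L v)ˣ, (∀ w' : PlacesOver L v, Valued.v (((u : LocalRing L v) w') - 1) < 1) →
      conjLocal L (IsCMField.complexConj L) v (u : LocalRing L v) = u → χ₁ u = 1)
    {ϖ : w.1.adicCompletion L} (hϖ : Valued.v ϖ = WithZero.exp (-1 : ℤ)) {m : ℕ} (hm : 1 ≤ m)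
    (u₁ : (LocalRing L v)ˣ) (hu₁ : ∀ w' : PlacesOver L v, Valued.v (((u₁ : LocalRing L v) w') - 1) ≤ Valued.v ϖ ^ m) (hχu₁ : χ₁ u₁ ≠ 1) :
    ∫ y in {y : ↥(HeisRing.skewPart (conjLocal L (IsCMField.complexConj L) v)) | Valued.v ((y : LocalRing L v) w) ≤ Valued.v ϖ ^ m},
        (fun r : LocalRing L v => if h : IsUnit r then ((χ₁ h.unit : ℂˣ) : ℂ) else 0) (1 + (y : LocalRing L v)) ∂μY = 0 := by
  obtain ⟨hpow, h0, h1⟩ := valued_pow_uniformizer L v w hϖ hm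
  have h := setIntegral_skewBall_dite_one_add_eq_zero_of_level_principal L v w hw μY h2w χ₁ h₁ hfixP (ϖ ^ m) (by rw [hpow]; exact h0) (by rw [hpow]; exact h1)
    u₁ (by rw [hpow]; exact hu₁ w) hχu₁
  rwa [hpow] at h

open scoped Classical in
include hw in
/-- **LEMMA S AT LEVEL `|Π|ᵐ`, VANISHING CASE, `χ₁⁻¹` reading** (the ramified entries integrate `χ₁(σz)⁻¹`). [cite: Keys1984, §4–§5, §7 Theorem (2) (d) p. 126] -/
theorem setIntegral_skewBall_pow_diteInv_one_add_eq_zero (h2w : Valued.v (2 : w.1.adicCompletion L) = 1)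
    (χ₁ : (LocalRing L v)ˣ →* ℂˣ) (h₁ : Continuous fun x => ((χ₁ x : ℂˣ) : ℂ))
    (hfixP : ∀ u : (LocalRing L v)ˣ, (∀ w' : PlacesOver L v, Valued.v (((u : LocalRing L v) w') - 1) < 1) →
      conjLocal L (IsCMField.complexConj L) v (u : LocalRing L v) = u → χ₁ u = 1)
    {ϖ : w.1.adicCompletion L} (hϖ : Valued.v ϖ = WithZero.exp (-1 : ℤ)) {m : ℕ} (hm : 1 ≤ m)
    (u₁ : (LocalRing L v)ˣ) (hu₁ : ∀ w' : PlacesOver L v, Valued.v (((u₁ : LocalRing L v) w') - 1) ≤ Valued.v ϖ ^ m) (hχu₁ : χ₁ u₁ ≠ 1) :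
    ∫ y in {y : ↥(HeisRing.skewPart (conjLocal L (IsCMField.complexConj L) v)) | Valued.v ((y : LocalRing L v) w) ≤ Valued.v ϖ ^ m},
        (fun r : LocalRing L v => if h : IsUnit r then (((χ₁ h.unit)⁻¹ : ℂˣ) : ℂ) else 0) (1 + (y : LocalRing L v)) ∂μY = 0 := by
  obtain ⟨h₁', hfixP', hχ'⟩ := inv_letters_principal L v χ₁ h₁ hfixP u₁ hχu₁
  exact setIntegral_skewBall_pow_dite_one_add_eq_zero L v w hw μY h2w χ₁⁻¹ h₁' hfixP' hϖ hm u₁ hu₁ hχ'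

open scoped Classical in
include hw in
omit [μY.IsAddHaarMeasure] [μY.Regular] in
/-- **LEMMA S AT LEVEL `|Π|ᵐ`, MASS CASE (`n ≤ m`: the shells `m ≥ n = cond χ₁`)** — `∫_{t ∈ R⁻, |t|_w ≤ |Π|_wᵐ} χ₁((1 + t)^) dμ⁻(t) = μ⁻{|t|_w ≤ |Π|_wᵐ}` when `χ₁` is trivial at
conductor level `n` (`hcond`, ★ C-pack p863496's bytes) and `1 ≤ n ≤ m`.  (★ PART 2 (ii), place-free, read at `r = Πᵐ`.) [cite: Keys1984, §4] [cite: WeilBNT1967, Ch. II §5] -/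
theorem setIntegral_skewBall_pow_dite_one_add_eq_measureReal (χ₁ : (LocalRing L v)ˣ →* ℂˣ)
    {ϖ : w.1.adicCompletion L} (hϖ : Valued.v ϖ = WithZero.exp (-1 : ℤ)) {n m : ℕ} (hn : 1 ≤ n) (hnm : n ≤ m)
    (hcond : ∀ u : (LocalRing L v)ˣ, (∀ w' : PlacesOver L v, Valued.v (((u : LocalRing L v) w') - 1) ≤ Valued.v ϖ ^ n) → χ₁ u = 1) :
    ∫ y in {y : ↥(HeisRing.skewPart (conjLocal L (IsCMField.complexConj L) v)) | Valued.v ((y : LocalRing L v) w) ≤ Valued.v ϖ ^ m},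
        (fun r : LocalRing L v => if h : IsUnit r then ((χ₁ h.unit : ℂˣ) : ℂ) else 0) (1 + (y : LocalRing L v)) ∂μY =
      (μY.real {y : ↥(HeisRing.skewPart (conjLocal L (IsCMField.complexConj L) v)) | Valued.v ((y : LocalRing L v) w) ≤ Valued.v ϖ ^ m} : ℂ) := by
  haveI : Algebra.IsQuadraticExtension ↥(maximalRealSubfield L) L := IsCMField.isQuadraticExtension L
  haveI : Subsingleton (PlacesOver L v) := PlacesOver.subsingleton_of_smul_eq (IsCMField.complexConj L) (IsCMField.complexConj_ne_one L) w hw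
  obtain ⟨hpow, -, h1⟩ := valued_pow_uniformizer L v w hϖ (hn.trans hnm)
  have hle : Valued.v ϖ ^ m ≤ Valued.v ϖ ^ n :=
    pow_le_pow_right_of_le_one' (by rw [hϖ, ← WithZero.exp_zero, WithZero.exp_le_exp]; norm_num) hnm
  -- a radius element of `R` with `w`-component `Πᵐ`
  have h := setIntegral_skewBall_dite_one_add_eq_measureReal_of_trivial L v w hw μY χ₁ (Function.update (0 : LocalRing L v) w (ϖ ^ m))
    (by rw [Function.update_self, hpow]; exact h1) (fun u hu => hcond u fun w' => by
      rw [Subsingleton.elim w' w]; rw [Function.update_self, hpow] at hu; exact hu.trans hle)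
  simp only [Function.update_self, hpow] at h
  exact h

end SkewBall

end Summit.HodgeConjecture.HodgeConjecture.R90.S1.BposRamSkewBallCharacterIntegral

end
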